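import Mathlib
import HarnessLib

/-!
# LatticeQCDFlow / Scaling — kurtosis `≤ 3` is preserved by independent sums
# (`E(Σᵢ Xᵢ)⁴ ≤ 3·(E(Σᵢ Xᵢ)²)²` for independent, centred, platykurtic `Xᵢ`)

HONEST FRAMING: exact (Metropolis-corrected) sampling algorithms for lattice gauge theory;
figures of merit are autocorrelation/cost numbers at stated couplings and volumes; no
continuum-physics claim.

Venture `LatticeQCDFlow` (cell pub-lqcd), topic `Scaling`; FANOUT row 3 (`s0-u1-a`, S0-B
implementation A, GEN-18).  NEW WORK of the cell (moment bookkeeping), not a published result; NO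
definition is introduced; imports Mathlib only.

Purpose.  Row 3's two-sided law for the strong-coupling acceptance slope of the untrained sampler
(`Scaling/GiniMeanDifferenceVarianceBounds`, GEN-18) bounds the slope `½E|T − T′|` from BELOW by
`σ_T/√6` whenever the tilt statistic `T` has fourth central moment `≤ 3σ_T⁴` (kurtosis at most that
of a Gaussian).  For the factorised models `T = Σᵢ Xᵢ` is a sum of INDEPENDENT plaquette terms, and
this file supplies the moment fact that makes the hypothesis volume-independent:

* `integral_add_sq_of_indepFun`, `integral_add_pow_four_of_indepFun` — for independent centred
  `S`, `Y ∈ L⁴`: `E(S+Y)² = ES² + EY²`, `E(S+Y)⁴ = ES⁴ + 6·ES²·EY² + EY⁴`;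
* `kurtosis_add_le_of_indepFun` — if moreover `ES⁴ ≤ 3(ES²)²` and `EY⁴ ≤ 3(EY²)²` then
  `E(S+Y)⁴ ≤ 3(E(S+Y)²)²`;
* **`pi_sum_moments`** — on a product of probability spaces (`Measure.pi μ`), for measurable
  centred `Xᵢ ∈ L⁴(μᵢ)` with `E Xᵢ⁴ ≤ 3(E Xᵢ²)²`: the coordinate sum `S(ω) = Σᵢ Xᵢ(ωᵢ)` is in `L⁴`,
  centred, `E S² = Σᵢ E Xᵢ²` and **`E S⁴ ≤ 3(E S²)²`** (induction on the index set with Mathlib's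
  `iIndepFun_pi` / `indepFun_finsetSum_of_notMem`);
* `intervalIntegral_cos_pow_four`, `cos_uniform_moments` — one U(1) plaquette angle under the Haar
  probability `(2π)⁻¹dθ` (row 3's `isProbabilityMeasure_uniform_Ioc`): `E cos = 0`, `E cos² = ½`, `E cos⁴ = 3/8 ≤ 3·(½)²`;
* **`u1_sum_cos_fourth_moment_le`** — `E(Σᵢ cos θᵢ)⁴ ≤ 3·(E(Σᵢ cos θᵢ)²)²` and `E(Σᵢ cos θᵢ)² = V/2`
  under the product of the one-angle Haar probabilities (every finite plaquette set).

[folklore: cumulant additivity `κ₄(S+Y) = κ₄(S) + κ₄(Y)` for independent variables, of which the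
kurtosis statement is the sign; no source is relied on.]
-/

noncomputable section

namespace Summit.Ventures.LatticeQCDFlow.Theory2

open MeasureTheory ProbabilityTheory Finset Real Set

/-! ## §1 One independent step -/

section Step

variable {Ω : Type*} [MeasurableSpace Ω] {P : Measure Ω} {S Y : Ω → ℝ}

/-- Natural powers of exponent `≤ 4` of an `L⁴` variable are integrable on a probability space.
[folklore] -/
theorem integrable_pow_of_memLp_four [IsProbabilityMeasure P] (hS : MemLp S 4 P)
    (hSm : Measurable S) {k : ℕ} (hk : k ≤ 4) :
    Integrable (fun ω => S ω ^ k) P := by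
  rcases Nat.eq_zero_or_pos k with rfl | hk0
  · simp only [pow_zero]; exact integrable_const _
  have hk' : MemLp S (k : ENNReal) P := hS.mono_exponent (by exact_mod_cast hk)
  have h := hk'.integrable_norm_pow (Nat.pos_iff_ne_zero.1 hk0)
  refine h.mono' ((hSm.pow_const k).aestronglyMeasurable) (ae_of_all _ fun ω => ?_)
  rw [Real.norm_eq_abs, Real.norm_eq_abs, abs_pow]

/-- `E[S^k · Y^l] = E[S^k]·E[Y^l]` for independent `S`, `Y` (no integrability needed). [folklore] -/
theorem integral_pow_mul_pow_eq (hind : IndepFun S Y P) (hSm : Measurable S) (hYm : Measurable Y)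
    (k l : ℕ) :
    ∫ ω, S ω ^ k * Y ω ^ l ∂P = (∫ ω, S ω ^ k ∂P) * ∫ ω, Y ω ^ l ∂P :=
  (hind.comp (measurable_id.pow_const k) (measurable_id.pow_const l)).integral_fun_mul_eq_mul_integral
    (hSm.pow_const k).aestronglyMeasurable (hYm.pow_const l).aestronglyMeasurable

/-- `S^k · Y^l` is integrable for independent `S, Y ∈ L⁴` and `k, l ≤ 4` (independence: it suffices
that both factors are integrable). [folklore] -/
theorem integrable_pow_mul_pow [IsProbabilityMeasure P] (hind : IndepFun S Y P) (hSm : Measurable S)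
    (hYm : Measurable Y) (hS4 : MemLp S 4 P) (hY4 : MemLp Y 4 P) {k l : ℕ} (hk : k ≤ 4)
    (hl : l ≤ 4) : Integrable (fun ω => S ω ^ k * Y ω ^ l) P :=
  (hind.comp (measurable_id.pow_const k) (measurable_id.pow_const l)).integrable_mul
    (integrable_pow_of_memLp_four hS4 hSm hk) (integrable_pow_of_memLp_four hY4 hYm hl)

/-- **`E(S + Y)² = ES² + EY²`** for independent centred `S, Y ∈ L⁴` (`L²` would do). [folklore] -/
theorem integral_add_sq_of_indepFun [IsProbabilityMeasure P] (hind : IndepFun S Y P)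
    (hSm : Measurable S) (hYm : Measurable Y) (hS4 : MemLp S 4 P) (hY4 : MemLp Y 4 P)
    (hS0 : ∫ ω, S ω ∂P = 0) (hY0 : ∫ ω, Y ω ∂P = 0) :
    ∫ ω, (S ω + Y ω) ^ 2 ∂P = ∫ ω, S ω ^ 2 ∂P + ∫ ω, Y ω ^ 2 ∂P := by
  have i20 := integrable_pow_of_memLp_four hS4 hSm (by norm_num : 2 ≤ 4)
  have i02 := integrable_pow_of_memLp_four hY4 hYm (by norm_num : 2 ≤ 4)
  have i11 := integrable_pow_mul_pow hind hSm hYm hS4 hY4 (k := 1) (l := 1) (by norm_num) (by norm_num)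
  have e11 := integral_pow_mul_pow_eq hind hSm hYm 1 1
  simp only [pow_one] at i11 e11
  have e : (fun ω => (S ω + Y ω) ^ 2) = fun ω => (S ω ^ 2 + 2 * (S ω * Y ω)) + Y ω ^ 2 := by
    funext ω; ring
  have iA : Integrable (fun ω => S ω ^ 2 + 2 * (S ω * Y ω)) P := i20.fun_add (i11.const_mul 2)
  rw [e, integral_add iA i02, integral_add i20 (i11.const_mul 2), integral_const_mul, e11, hS0, hY0]
  ring

/-- **`E(S + Y)⁴ = ES⁴ + 6·ES²·EY² + EY⁴`** for independent centred `S, Y ∈ L⁴` (the odd cross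
moments `E[S³Y] = ES³·EY` and `E[SY³] = ES·EY³` vanish). [folklore] -/
theorem integral_add_pow_four_of_indepFun [IsProbabilityMeasure P] (hind : IndepFun S Y P)
    (hSm : Measurable S) (hYm : Measurable Y) (hS4 : MemLp S 4 P) (hY4 : MemLp Y 4 P)
    (hS0 : ∫ ω, S ω ∂P = 0) (hY0 : ∫ ω, Y ω ∂P = 0) :
    ∫ ω, (S ω + Y ω) ^ 4 ∂P
      = ∫ ω, S ω ^ 4 ∂P + 6 * ((∫ ω, S ω ^ 2 ∂P) * ∫ ω, Y ω ^ 2 ∂P) + ∫ ω, Y ω ^ 4 ∂P := by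
  have i40 := integrable_pow_of_memLp_four hS4 hSm (le_refl 4)
  have i04 := integrable_pow_of_memLp_four hY4 hYm (le_refl 4)
  have i31 := integrable_pow_mul_pow hind hSm hYm hS4 hY4 (k := 3) (l := 1) (by norm_num) (by norm_num)
  have i22 := integrable_pow_mul_pow hind hSm hYm hS4 hY4 (k := 2) (l := 2) (by norm_num) (by norm_num)
  have i13 := integrable_pow_mul_pow hind hSm hYm hS4 hY4 (k := 1) (l := 3) (by norm_num) (by norm_num)
  have e31 := integral_pow_mul_pow_eq hind hSm hYm 3 1
  have e22 := integral_pow_mul_pow_eq hind hSm hYm 2 2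
  have e13 := integral_pow_mul_pow_eq hind hSm hYm 1 3
  simp only [pow_one] at i31 i13 e31 e13
  have e : (fun ω => (S ω + Y ω) ^ 4) = fun ω =>
      (((S ω ^ 4 + 4 * (S ω ^ 3 * Y ω)) + 6 * (S ω ^ 2 * Y ω ^ 2)) + 4 * (S ω * Y ω ^ 3)) + Y ω ^ 4 := by
    funext ω; ring
  have iA : Integrable (fun ω => S ω ^ 4 + 4 * (S ω ^ 3 * Y ω)) P := i40.fun_add (i31.const_mul 4)
  have iB : Integrable (fun ω => (S ω ^ 4 + 4 * (S ω ^ 3 * Y ω)) + 6 * (S ω ^ 2 * Y ω ^ 2)) P :=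
    iA.fun_add (i22.const_mul 6)
  have iC : Integrable (fun ω => ((S ω ^ 4 + 4 * (S ω ^ 3 * Y ω)) + 6 * (S ω ^ 2 * Y ω ^ 2))
      + 4 * (S ω * Y ω ^ 3)) P := iB.fun_add (i13.const_mul 4)
  rw [e, integral_add iC i04, integral_add iB (i13.const_mul 4), integral_add iA (i22.const_mul 6),
    integral_add i40 (i31.const_mul 4), integral_const_mul, integral_const_mul, integral_const_mul,
    e31, e22, e13, hS0, hY0]
  ring

/-- **Kurtosis `≤ 3` is preserved under an independent sum**: if `ES⁴ ≤ 3(ES²)²` and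
`EY⁴ ≤ 3(EY²)²` then `E(S+Y)⁴ ≤ 3(E(S+Y)²)²` (`= 3(ES²)² + 6ES²EY² + 3(EY²)²`). [folklore] -/
theorem kurtosis_add_le_of_indepFun [IsProbabilityMeasure P] (hind : IndepFun S Y P)
    (hSm : Measurable S) (hYm : Measurable Y) (hS4 : MemLp S 4 P) (hY4 : MemLp Y 4 P)
    (hS0 : ∫ ω, S ω ∂P = 0) (hY0 : ∫ ω, Y ω ∂P = 0)
    (hS : ∫ ω, S ω ^ 4 ∂P ≤ 3 * (∫ ω, S ω ^ 2 ∂P) ^ 2)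
    (hY : ∫ ω, Y ω ^ 4 ∂P ≤ 3 * (∫ ω, Y ω ^ 2 ∂P) ^ 2) :
    ∫ ω, (S ω + Y ω) ^ 4 ∂P ≤ 3 * (∫ ω, (S ω + Y ω) ^ 2 ∂P) ^ 2 := by
  rw [integral_add_pow_four_of_indepFun hind hSm hYm hS4 hY4 hS0 hY0,
    integral_add_sq_of_indepFun hind hSm hYm hS4 hY4 hS0 hY0]
  nlinarith [sq_nonneg (∫ ω, S ω ^ 2 ∂P - ∫ ω, Y ω ^ 2 ∂P)]

end Step

/-! ## §2 Coordinate sums on a product of probability spaces -/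

section Pi

variable {ι : Type*} [Fintype ι] {Ω : ι → Type*} [∀ i, MeasurableSpace (Ω i)]
  {μ : ∀ i, Measure (Ω i)} [∀ i, IsProbabilityMeasure (μ i)] {X : ∀ i, Ω i → ℝ}
  (hXm : ∀ i, Measurable (X i)) (h4 : ∀ i, MemLp (X i) 4 (μ i))
  (h0 : ∀ i, ∫ x, X i x ∂μ i = 0)
  (hk : ∀ i, ∫ x, X i x ^ 4 ∂μ i ≤ 3 * (∫ x, X i x ^ 2 ∂μ i) ^ 2)
include hXm h4 h0 hk

omit h4 h0 hk in
/-- Transport of a one-coordinate integral to the product space. [folklore] -/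
theorem integral_pi_eval_comp {i : ι} {φ : ℝ → ℝ} (hφ : Measurable φ) :
    ∫ ω, φ (X i (ω i)) ∂Measure.pi μ = ∫ x, φ (X i x) ∂μ i := by
  have hev : AEMeasurable (Function.eval i) (Measure.pi μ) := (measurable_pi_apply i).aemeasurable
  have hg : AEStronglyMeasurable (fun x => φ (X i x)) (Measure.map (Function.eval i) (Measure.pi μ)) :=
    (hφ.comp (hXm i)).aestronglyMeasurable
  rw [← (measurePreserving_eval μ i).map_eq, integral_map hev hg]

/-- **Moments of a coordinate sum on a product of probability spaces.**  For measurable centred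
`Xᵢ ∈ L⁴(μᵢ)` with `E Xᵢ⁴ ≤ 3(E Xᵢ²)²`, the sum `S(ω) = Σ_{i ∈ s} Xᵢ(ωᵢ)` under `Measure.pi μ`
is in `L⁴`, centred, has `E S² = Σ_{i∈s} E Xᵢ²`, and **`E S⁴ ≤ 3·(E S²)²`**. [folklore] -/
theorem pi_finsetSum_moments (s : Finset ι) :
    MemLp (fun ω => ∑ i ∈ s, X i (ω i)) 4 (Measure.pi μ)
      ∧ ∫ ω, (∑ i ∈ s, X i (ω i)) ∂Measure.pi μ = 0
      ∧ ∫ ω, (∑ i ∈ s, X i (ω i)) ^ 2 ∂Measure.pi μ = ∑ i ∈ s, ∫ x, X i x ^ 2 ∂μ i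
      ∧ ∫ ω, (∑ i ∈ s, X i (ω i)) ^ 4 ∂Measure.pi μ
          ≤ 3 * (∫ ω, (∑ i ∈ s, X i (ω i)) ^ 2 ∂Measure.pi μ) ^ 2 := by
  classical
  induction s using Finset.induction_on with
  | empty =>
    refine ⟨?_, ?_, ?_, ?_⟩
    · simp only [sum_empty]; exact memLp_const (0 : ℝ)
    · simp only [sum_empty, integral_zero]
    · simp
    · simp
  | insert j s hj ih =>
    obtain ⟨ihL, ih0, ih2, ih4⟩ := ih
    -- the new coordinate and its independence from the partial sum
    have hYj : MemLp (fun ω : (∀ i, Ω i) => X j (ω j)) 4 (Measure.pi μ) :=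
      (h4 j).comp_measurePreserving (measurePreserving_eval μ j)
    have hYm : Measurable fun ω : (∀ i, Ω i) => X j (ω j) := (hXm j).comp (measurable_pi_apply j)
    have hSm : Measurable fun ω : (∀ i, Ω i) => ∑ i ∈ s, X i (ω i) :=
      Finset.measurable_sum s fun i _ => (hXm i).comp (measurable_pi_apply i)
    have hind : IndepFun (fun ω : (∀ i, Ω i) => ∑ i ∈ s, X i (ω i)) (fun ω => X j (ω j))
        (Measure.pi μ) := by
      have h := (iIndepFun_pi (μ := μ) (X := X) fun i => (hXm i).aemeasurable).indepFun_finsetSum_of_notMem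
        (fun i => (hXm i).comp (measurable_pi_apply i)) hj
      rwa [Finset.sum_fn] at h
    have hY0 : ∫ ω, X j (ω j) ∂Measure.pi μ = 0 := by
      have h := integral_pi_eval_comp (μ := μ) hXm (i := j) measurable_id
      simp only [id] at h
      rw [h, h0 j]
    have hY2 : ∫ ω, X j (ω j) ^ 2 ∂Measure.pi μ = ∫ x, X j x ^ 2 ∂μ j :=
      integral_pi_eval_comp hXm (i := j) (measurable_id.pow_const 2)
    have hY4' : ∫ ω, X j (ω j) ^ 4 ∂Measure.pi μ = ∫ x, X j x ^ 4 ∂μ j :=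
      integral_pi_eval_comp hXm (i := j) (measurable_id.pow_const 4)
    have hYk : ∫ ω, X j (ω j) ^ 4 ∂Measure.pi μ ≤ 3 * (∫ ω, X j (ω j) ^ 2 ∂Measure.pi μ) ^ 2 := by
      rw [hY2, hY4']; exact hk j
    -- rewrite `Σ_{insert j s}` as `Σ_s + X j (ω j)` under the binders
    have ec : ∀ ω : (∀ i, Ω i), ∑ i ∈ insert j s, X i (ω i) = (∑ i ∈ s, X i (ω i)) + X j (ω j) :=
      fun ω => by rw [Finset.sum_insert hj, add_comm]
    simp only [ec]
    refine ⟨?_, ?_, ?_, ?_⟩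
    · exact ihL.add hYj
    · rw [integral_add (ihL.integrable (by norm_num)) (hYj.integrable (by norm_num)), ih0, hY0,
        add_zero]
    · rw [integral_add_sq_of_indepFun hind hSm hYm ihL hYj ih0 hY0, ih2, hY2, Finset.sum_insert hj,
        add_comm]
    · exact kurtosis_add_le_of_indepFun hind hSm hYm ihL hYj ih0 hY0 ih4 hYk

/-- The full coordinate sum: `S ∈ L⁴`, `E S = 0`, `E S² = Σᵢ E Xᵢ²`, `E S⁴ ≤ 3(E S²)²`. [folklore] -/
theorem pi_sum_moments :
    MemLp (fun ω => ∑ i, X i (ω i)) 4 (Measure.pi μ)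
      ∧ ∫ ω, (∑ i, X i (ω i)) ∂Measure.pi μ = 0
      ∧ ∫ ω, (∑ i, X i (ω i)) ^ 2 ∂Measure.pi μ = ∑ i, ∫ x, X i x ^ 2 ∂μ i
      ∧ ∫ ω, (∑ i, X i (ω i)) ^ 4 ∂Measure.pi μ
          ≤ 3 * (∫ ω, (∑ i, X i (ω i)) ^ 2 ∂Measure.pi μ) ^ 2 :=
  pi_finsetSum_moments hXm h4 h0 hk Finset.univ

end Pi

/-! ## §3 One U(1) plaquette angle: `E cos = 0`, `E cos² = ½`, `E cos⁴ = 3/8` -/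

section U1

/-- `∫₀^{2π} cos⁴ θ dθ = 3π/4` (Mathlib's reduction formula `integral_cos_pow`). [folklore] -/
theorem intervalIntegral_cos_pow_four :
    ∫ θ in (0 : ℝ)..2 * π, Real.cos θ ^ 4 = 3 * π / 4 := by
  have h4 := integral_cos_pow (a := 0) (b := 2 * π) (n := 2)
  have h2 : ∫ θ in (0 : ℝ)..2 * π, Real.cos θ ^ 2 = π := by
    rw [integral_cos_sq, Real.sin_two_pi, Real.sin_zero]
    ring
  rw [show (2 : ℕ) + 2 = 4 by norm_num] at h4
  rw [h4, h2, Real.sin_two_pi, Real.sin_zero]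
  push_cast
  ring

/-- Moments of one plaquette cosine under the Haar PROBABILITY `(2π)⁻¹·Leb` on `(0, 2π]`:
`E cos = 0`, `E cos² = ½`, `E cos⁴ = 3/8`. [folklore] -/
theorem cos_uniform_moments :
    (∫ θ, Real.cos θ ∂((ENNReal.ofReal (2 * π))⁻¹ • volume.restrict (Ioc (0 : ℝ) (2 * π))) = 0)
      ∧ (∫ θ, Real.cos θ ^ 2 ∂((ENNReal.ofReal (2 * π))⁻¹ • volume.restrict (Ioc (0 : ℝ) (2 * π)))
          = 1 / 2)
      ∧ (∫ θ, Real.cos θ ^ 4 ∂((ENNReal.ofReal (2 * π))⁻¹ • volume.restrict (Ioc (0 : ℝ) (2 * π)))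
          = 3 / 8) := by
  have h2π : (0 : ℝ) ≤ 2 * π := by positivity
  have hc : ((ENNReal.ofReal (2 * π))⁻¹).toReal = (2 * π)⁻¹ := by
    rw [ENNReal.toReal_inv, ENNReal.toReal_ofReal h2π]
  have hπ : π ≠ 0 := Real.pi_ne_zero
  refine ⟨?_, ?_, ?_⟩
  · rw [integral_smul_measure, ← intervalIntegral.integral_of_le h2π, integral_cos, hc, smul_eq_mul,
      Real.sin_two_pi, Real.sin_zero]
    ring
  · rw [integral_smul_measure, ← intervalIntegral.integral_of_le h2π, integral_cos_sq, hc, smul_eq_mul,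
      Real.sin_two_pi, Real.sin_zero]
    field_simp
    ring
  · rw [integral_smul_measure, ← intervalIntegral.integral_of_le h2π, intervalIntegral_cos_pow_four,
      hc, smul_eq_mul]
    field_simp
    ring

/-- `cos ∈ L⁴` under the one-angle Haar probability (indeed under the finite measure
`(2π)⁻¹·Leb|(0,2π]`; that it is a probability measure is row 3's `isProbabilityMeasure_uniform_Ioc` in
`Scaling/IdentityFlowStrongCoupling`, not restated here). [folklore] -/
theorem memLp_four_cos_uniform :
    MemLp (fun θ => Real.cos θ) 4
      ((ENNReal.ofReal (2 * π))⁻¹ • volume.restrict (Ioc (0 : ℝ) (2 * π))) := by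
  haveI : IsProbabilityMeasure ((ENNReal.ofReal (2 * π))⁻¹ • volume.restrict (Ioc (0 : ℝ) (2 * π))) :=
    ⟨by rw [Measure.smul_apply, Measure.restrict_apply_univ, Real.volume_Ioc, sub_zero, smul_eq_mul,
      ENNReal.inv_mul_cancel (ENNReal.ofReal_pos.2 (by positivity : (0 : ℝ) < 2 * π)).ne'
        ENNReal.ofReal_ne_top]⟩
  exact MemLp.of_bound Real.continuous_cos.aestronglyMeasurable 1
    (ae_of_all _ fun θ => by rw [Real.norm_eq_abs]; exact Real.abs_cos_le_one θ)

variable {ι : Type*} [Fintype ι]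

/-- **THE TOTAL PLAQUETTE COSINE IS PLATYKURTIC**: under the product of the one-angle Haar
probabilities on `V` plaquette angles, `T = Σᵢ cos θᵢ` satisfies `E T = 0`, `E T² = V/2` and
**`E T⁴ ≤ 3·(E T²)²`** (exactly `E T⁴ = 3V²/4 − 3V/8`; only the inequality is recorded). [ours] -/
theorem u1_sum_cos_fourth_moment_le :
    MemLp (fun x : ι → ℝ => ∑ i, Real.cos (x i)) 4
        (Measure.pi fun _ : ι => (ENNReal.ofReal (2 * π))⁻¹ • volume.restrict (Ioc (0 : ℝ) (2 * π)))
      ∧ ∫ x, (∑ i, Real.cos (x i))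
          ∂(Measure.pi fun _ : ι => (ENNReal.ofReal (2 * π))⁻¹ • volume.restrict (Ioc (0 : ℝ) (2 * π)))
          = 0
      ∧ ∫ x, (∑ i, Real.cos (x i)) ^ 2
          ∂(Measure.pi fun _ : ι => (ENNReal.ofReal (2 * π))⁻¹ • volume.restrict (Ioc (0 : ℝ) (2 * π)))
          = Fintype.card ι / 2
      ∧ ∫ x, (∑ i, Real.cos (x i)) ^ 4
          ∂(Measure.pi fun _ : ι => (ENNReal.ofReal (2 * π))⁻¹ • volume.restrict (Ioc (0 : ℝ) (2 * π)))
          ≤ 3 * (∫ x, (∑ i, Real.cos (x i)) ^ 2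
            ∂(Measure.pi fun _ : ι => (ENNReal.ofReal (2 * π))⁻¹
              • volume.restrict (Ioc (0 : ℝ) (2 * π)))) ^ 2 := by
  haveI : IsProbabilityMeasure ((ENNReal.ofReal (2 * π))⁻¹ • volume.restrict (Ioc (0 : ℝ) (2 * π))) :=
    ⟨by rw [Measure.smul_apply, Measure.restrict_apply_univ, Real.volume_Ioc, sub_zero, smul_eq_mul,
      ENNReal.inv_mul_cancel (ENNReal.ofReal_pos.2 (by positivity : (0 : ℝ) < 2 * π)).ne'
        ENNReal.ofReal_ne_top]⟩
  obtain ⟨m0, m2, m4⟩ := cos_uniform_moments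
  have h := pi_sum_moments (μ := fun _ : ι => (ENNReal.ofReal (2 * π))⁻¹ • volume.restrict (Ioc (0 : ℝ) (2 * π)))
    (X := fun _ θ => Real.cos θ) (fun _ => Real.measurable_cos) (fun _ => memLp_four_cos_uniform)
    (fun _ => m0) (fun _ => by rw [m4, m2]; norm_num)
  obtain ⟨hL, h0', h2', h4'⟩ := h
  refine ⟨hL, h0', ?_, h4'⟩
  rw [h2']
  simp only [m2, sum_const, card_univ]
  ring

end U1

end Summit.Ventures.LatticeQCDFlow.Theory2

/-! ## §4 The exact fourth moment: fourth cumulants of independent centred variables add -/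

namespace Summit.Ventures.LatticeQCDFlow.Theory2

open MeasureTheory ProbabilityTheory Finset Real Set

section PiExact

variable {ι : Type*} [Fintype ι] {Ω : ι → Type*} [∀ i, MeasurableSpace (Ω i)]
  {μ : ∀ i, Measure (Ω i)} [∀ i, IsProbabilityMeasure (μ i)] {X : ∀ i, Ω i → ℝ}
  (hXm : ∀ i, Measurable (X i)) (h4 : ∀ i, MemLp (X i) 4 (μ i)) (h0 : ∀ i, ∫ x, X i x ∂μ i = 0)
include hXm h4 h0

/-- **EXACT FOURTH MOMENT OF A CENTRED INDEPENDENT SUM** (no kurtosis hypothesis): for measurable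
centred `Xᵢ ∈ L⁴(μᵢ)` and `S = Σ_{i∈s} Xᵢ(ωᵢ)` under `Measure.pi μ`: `S ∈ L⁴`, `E S = 0`,
`E S² = Σ E Xᵢ²` and `E S⁴ = Σ E Xᵢ⁴ + 3·((Σ E Xᵢ²)² − Σ (E Xᵢ²)²)` — the fourth cumulant
`E X⁴ − 3(E X²)²` is additive. [folklore] -/
theorem pi_finsetSum_fourth_moment_eq (s : Finset ι) :
    MemLp (fun ω => ∑ i ∈ s, X i (ω i)) 4 (Measure.pi μ)
      ∧ ∫ ω, (∑ i ∈ s, X i (ω i)) ∂Measure.pi μ = 0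
      ∧ ∫ ω, (∑ i ∈ s, X i (ω i)) ^ 2 ∂Measure.pi μ = ∑ i ∈ s, ∫ x, X i x ^ 2 ∂μ i
      ∧ ∫ ω, (∑ i ∈ s, X i (ω i)) ^ 4 ∂Measure.pi μ
          = ∑ i ∈ s, ∫ x, X i x ^ 4 ∂μ i
            + 3 * ((∑ i ∈ s, ∫ x, X i x ^ 2 ∂μ i) ^ 2 - ∑ i ∈ s, (∫ x, X i x ^ 2 ∂μ i) ^ 2) := by
  classical
  induction s using Finset.induction_on with
  | empty =>
    refine ⟨?_, ?_, ?_, ?_⟩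
    · simp only [sum_empty]; exact memLp_const (0 : ℝ)
    · simp only [sum_empty, integral_zero]
    · simp
    · simp
  | insert j s hj ih =>
    obtain ⟨ihL, ih0, ih2, ih4⟩ := ih
    have hYj : MemLp (fun ω : (∀ i, Ω i) => X j (ω j)) 4 (Measure.pi μ) :=
      (h4 j).comp_measurePreserving (measurePreserving_eval μ j)
    have hYm : Measurable fun ω : (∀ i, Ω i) => X j (ω j) := (hXm j).comp (measurable_pi_apply j)
    have hSm : Measurable fun ω : (∀ i, Ω i) => ∑ i ∈ s, X i (ω i) :=
      Finset.measurable_sum s fun i _ => (hXm i).comp (measurable_pi_apply i)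
    have hind : IndepFun (fun ω : (∀ i, Ω i) => ∑ i ∈ s, X i (ω i)) (fun ω => X j (ω j))
        (Measure.pi μ) := by
      have h := (iIndepFun_pi (μ := μ) (X := X) fun i => (hXm i).aemeasurable).indepFun_finsetSum_of_notMem
        (fun i => (hXm i).comp (measurable_pi_apply i)) hj
      rwa [Finset.sum_fn] at h
    have hY0 : ∫ ω, X j (ω j) ∂Measure.pi μ = 0 := by
      have h := integral_pi_eval_comp (μ := μ) hXm (i := j) measurable_id
      simp only [id] at h
      rw [h, h0 j]
    have hY2 : ∫ ω, X j (ω j) ^ 2 ∂Measure.pi μ = ∫ x, X j x ^ 2 ∂μ j :=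
      integral_pi_eval_comp hXm (i := j) (measurable_id.pow_const 2)
    have hY4' : ∫ ω, X j (ω j) ^ 4 ∂Measure.pi μ = ∫ x, X j x ^ 4 ∂μ j :=
      integral_pi_eval_comp hXm (i := j) (measurable_id.pow_const 4)
    have ec : ∀ ω : (∀ i, Ω i), ∑ i ∈ insert j s, X i (ω i) = (∑ i ∈ s, X i (ω i)) + X j (ω j) :=
      fun ω => by rw [Finset.sum_insert hj, add_comm]
    simp only [ec]
    refine ⟨ihL.add hYj, ?_, ?_, ?_⟩
    · rw [integral_add (ihL.integrable (by norm_num)) (hYj.integrable (by norm_num)), ih0, hY0,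
        add_zero]
    · rw [integral_add_sq_of_indepFun hind hSm hYm ihL hYj ih0 hY0, ih2, hY2, Finset.sum_insert hj,
        add_comm]
    · rw [integral_add_pow_four_of_indepFun hind hSm hYm ihL hYj ih0 hY0, ih4, ih2, hY2, hY4',
        Finset.sum_insert hj, Finset.sum_insert hj, Finset.sum_insert hj]
      ring

end PiExact

/-- **THE EXACT FOURTH MOMENT OF THE TOTAL PLAQUETTE COSINE**: under the product of the one-angle
Haar probabilities on `V` plaquette angles, `E(Σᵢ cos θᵢ)⁴ = 3V²/4 − 3V/8` (so the kurtosis is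
`3 − 3/(2V)`, increasing to the Gaussian value). [ours] -/
theorem u1_sum_cos_fourth_moment_eq {ι : Type*} [Fintype ι] :
    ∫ x, (∑ i, Real.cos (x i)) ^ 4
        ∂(Measure.pi fun _ : ι => (ENNReal.ofReal (2 * π))⁻¹ • volume.restrict (Ioc (0 : ℝ) (2 * π)))
      = 3 * (Fintype.card ι : ℝ) ^ 2 / 4 - 3 * Fintype.card ι / 8 := by
  haveI : IsProbabilityMeasure ((ENNReal.ofReal (2 * π))⁻¹ • volume.restrict (Ioc (0 : ℝ) (2 * π))) :=
    ⟨by rw [Measure.smul_apply, Measure.restrict_apply_univ, Real.volume_Ioc, sub_zero, smul_eq_mul,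
      ENNReal.inv_mul_cancel (ENNReal.ofReal_pos.2 (by positivity : (0 : ℝ) < 2 * π)).ne'
        ENNReal.ofReal_ne_top]⟩
  obtain ⟨m0, m2, m4⟩ := cos_uniform_moments
  obtain ⟨-, -, -, h⟩ := pi_finsetSum_fourth_moment_eq
    (μ := fun _ : ι => (ENNReal.ofReal (2 * π))⁻¹ • volume.restrict (Ioc (0 : ℝ) (2 * π)))
    (X := fun _ θ => Real.cos θ) (fun _ => Real.measurable_cos) (fun _ => memLp_four_cos_uniform)
    (fun _ => m0) Finset.univ
  rw [h]
  simp only [m2, m4, sum_const, card_univ, nsmul_eq_mul]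
  ring

end Summit.Ventures.LatticeQCDFlow.Theory2
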